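import Summits.RiemannHypothesis.RiemannHypothesis.Theorems.WeilParityOffLineParityDetectionStubEvenOffLineCauchySchwarz
import Literature.Barriers.HubbardSuperconductivity.WeakCouplingCeiling
import HarnessLib

/-!
# PF persistence — F3-S7 support: OFFSET BLINDNESS of the Weil window form (pub-rhpf fake-3, gen 6)

**HONEST FRAMING. This is a long-odds MECHANISM / RIGIDITY campaign; no RH claims.** Everything in this
file is RH-free, unconditional real analysis on a window `[-a, a]`; no DATA enters and nothing here is
specific to `ζ` (the Weil transform `weilMellin e ρ = ∫ e(t) e^{(ρ - 1/2) t} dt` of a test `e` is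
evaluated at an ARBITRARY point `ρ`, which in the applications is a zero of whatever `L`-datum is under
the window — `ζ`, an Epstein zeta function `Z_d`, a Hecke `L`-function, FAKES §3).

On the zero side of the explicit formula an off-line quadruple `{1/2 ± η ± iγ}` of a datum contributes the
indefinite rank-2 form `4 Re ê(1/2 + η + iγ)² = 4 (Re ê)² − 4 (Im ê)²` on a real even test `e`
(`weilfam` docstring; tree `neg_integral_sinh_sq_mul_sin_sq_le`), and for a real even `L²`-normalised `e`
supported in `[-a, a]` the tree proves the per-zero Cauchy–Schwarz threshold
`(Im ê(ρ))² ≤ ∫_{-a}^{a} sinh²(ηt) sin²(γt) dt` (`η = Re ρ − 1/2`, `γ = Im ρ`).  This file puts that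
threshold in CLOSED FORM, UNIFORMLY IN THE HEIGHT `γ`, and reads off its size in the offset `η`:

* §1 (PROVED) hyperbolic inequalities: from the tree lemma `sinh x ≤ x cosh x` (`x ≥ 0`;
  `Literature.Barriers.HubbardSuperconductivity.sinh_le_self_mul_cosh`), `sinh(ηt)² ≤ η² t² cosh(ηa)²` for `|t| ≤ a`.
* §2 (PROVED) `∫_{-a}^{a} sinh²(ηt) dt = sinh(ηa) cosh(ηa)/η − a` (`η ≠ 0`; `= sinh(2ηa)/(2η) − a`) and
  `∫_{-a}^{a} sinh²(ηt) dt ≤ (2/3) η² a³ cosh(ηa)²` (`a ≥ 0`).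
* §3 (PROVED) THE OFFSET-BLINDNESS BUDGET.  For continuous real `u`, `w` with `|w| ≤ 1` and
  `∫_{[-a,a]} u² = 1`: `(∫_{[-a,a]} u(t) sinh(ηt) w(t) dt)² ≤ sinh(ηa) cosh(ηa)/η − a ≤ (2/3) η² a³ cosh(ηa)²`
  (`sq_setIntegral_mul_sinh_mul_le`, `…_le_small`); for a real even `L²`-normalised Weil test `e`
  supported in `[-a, a]` and ANY `ρ` off the line `Re ρ = 1/2`:
  `(Im ê(ρ))² ≤ sinh(ηa) cosh(ηa)/η − a ≤ (2/3) η² a³ cosh(ηa)²` and hence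
  `Re (ê(ρ)²) ≥ −(2/3) η² a³ cosh(ηa)²` (`im_weilMellin_sq_le_offsetBudget`,
  `im_weilMellin_sq_le_offsetBudget_small`, `re_weilMellin_sq_ge_neg_offsetBudget`): the most an
  off-line quadruple at offset `η` can lower the window form at depth `a` on a unit real even test is
  `(8/3) η² a³ cosh(ηa)²`, whatever its height — quadruples with `η a ≪ 1` are invisible at depth `a`
  ("offset blindness"; FAKES §3.11, where the DATA show the Galerkin ground states of `Z_d` past the
  onset saturate 35–56 % of this budget at the one or two lowest off-line zeros and < 5 % below it).

What this does NOT say: nothing about the on-line part of the zero side (which is what actually keeps the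
form positive below the onset — DATA), nothing about which zeros exist for any datum, nothing about `ζ`.
-/

set_option linter.dupNamespace false  -- the mandated namespace repeats `RiemannHypothesis`

noncomputable section

open MeasureTheory Set Real

namespace Summit.RiemannHypothesis.RiemannHypothesis.Theorems.PfPersistence

open Literature.NumberTheory.LFunctions
open Summit.RiemannHypothesis.RiemannHypothesis.Theorems.WeilParityOffLineParityDetection
  (sq_integral_mul_le im_weilMellin_of_real_even)

/-! ## §1 Hyperbolic inequalities -/

-- `sinh x ≤ x cosh x` for `x ≥ 0` is the tree lemma
-- `Literature.Barriers.HubbardSuperconductivity.sinh_le_self_mul_cosh` (WeakCouplingCeiling §; [folklore]);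
-- it is used here by name rather than re-proved.
open Literature.Barriers.HubbardSuperconductivity (sinh_le_self_mul_cosh)

/-- `|sinh x| ≤ |x| cosh x` for every real `x` (from the Literature lemma `sinh_le_self_mul_cosh` by the odd/even
symmetry of `sinh`/`cosh`).  Local copy of `BraidExit.abs_sinh_le` (an AnomalousDissipation Theorems file — a
cross-summit Theorems import is not legal); no Literature home. [folklore] -/
theorem abs_sinh_le_abs_mul_cosh (x : ℝ) : |Real.sinh x| ≤ |x| * Real.cosh x := by
  rcases le_total 0 x with hx | hx
  · rw [abs_of_nonneg (Real.sinh_nonneg_iff.2 hx), abs_of_nonneg hx]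
    exact sinh_le_self_mul_cosh hx
  · have hx' : 0 ≤ -x := by linarith
    have h := sinh_le_self_mul_cosh hx'
    rw [Real.sinh_neg, Real.cosh_neg] at h
    rw [abs_of_nonpos (Real.sinh_nonpos_iff.2 hx), abs_of_nonpos hx]
    exact h

/-- `sinh(ηt)² ≤ η² t² cosh(ηa)²` for `|t| ≤ a`. [folklore] -/
theorem sinh_mul_sq_le {η t a : ℝ} (ht : |t| ≤ a) :
    Real.sinh (η * t) ^ 2 ≤ η ^ 2 * t ^ 2 * Real.cosh (η * a) ^ 2 := by
  have h1 : |Real.sinh (η * t)| ≤ |η * t| * Real.cosh (η * t) := abs_sinh_le_abs_mul_cosh _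
  have hcosh : Real.cosh (η * t) ≤ Real.cosh (η * a) := by
    rw [Real.cosh_le_cosh, abs_mul, abs_mul]
    exact mul_le_mul_of_nonneg_left (le_trans ht (le_abs_self a)) (abs_nonneg η)
  have h2 : |Real.sinh (η * t)| ≤ |η * t| * Real.cosh (η * a) :=
    h1.trans (mul_le_mul_of_nonneg_left hcosh (abs_nonneg _))
  have h3 : 0 ≤ |η * t| * Real.cosh (η * a) := mul_nonneg (abs_nonneg _) (Real.cosh_pos _).le
  calc Real.sinh (η * t) ^ 2 = |Real.sinh (η * t)| ^ 2 := (sq_abs _).symm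
    _ ≤ (|η * t| * Real.cosh (η * a)) ^ 2 := pow_le_pow_left₀ (abs_nonneg _) h2 2
    _ = η ^ 2 * t ^ 2 * Real.cosh (η * a) ^ 2 := by rw [mul_pow, sq_abs]; ring

/-! ## §2 The `sinh²` integral -/

/-- `∫_{-a}^{a} sinh²(ηt) dt = sinh(ηa) cosh(ηa)/η − a` for `η ≠ 0`
(antiderivative `sinh(ηt) cosh(ηt)/(2η) − t/2`). [folklore] -/
theorem integral_sinh_mul_sq {η : ℝ} (hη : η ≠ 0) (a : ℝ) :
    ∫ t in (-a)..a, Real.sinh (η * t) ^ 2 = Real.sinh (η * a) * Real.cosh (η * a) / η - a := by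
  have hd : ∀ t ∈ uIcc (-a) a, HasDerivAt (fun t ↦ Real.sinh (η * t) * Real.cosh (η * t) / (2 * η) - t / 2)
      (Real.sinh (η * t) ^ 2) t := by
    intro t _
    have hl : HasDerivAt (fun t : ℝ ↦ η * t) η t := by
      simpa using (hasDerivAt_id t).const_mul η
    have hs : HasDerivAt (fun t ↦ Real.sinh (η * t)) (Real.cosh (η * t) * η) t :=
      (Real.hasDerivAt_sinh (η * t)).comp t hl
    have hc : HasDerivAt (fun t ↦ Real.cosh (η * t)) (Real.sinh (η * t) * η) t :=
      (Real.hasDerivAt_cosh (η * t)).comp t hl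
    have hp := ((hs.mul hc).div_const (2 * η)).sub ((hasDerivAt_id t).div_const 2)
    refine hp.congr_deriv ?_
    have hc2 := Real.cosh_sq_sub_sinh_sq (η * t)
    field_simp
    linear_combination hc2
  rw [intervalIntegral.integral_eq_sub_of_hasDerivAt hd (by
    apply Continuous.intervalIntegrable; fun_prop)]
  have h1 : Real.sinh (η * -a) = -Real.sinh (η * a) := by rw [mul_neg, Real.sinh_neg]
  have h2 : Real.cosh (η * -a) = Real.cosh (η * a) := by rw [mul_neg, Real.cosh_neg]
  simp only [h1, h2]
  field_simp
  ring

/-- `∫_{-a}^{a} sinh²(ηt) dt ≤ (2/3) η² a³ cosh(ηa)²` for `a ≥ 0` (from `sinh(ηt)² ≤ η² t² cosh(ηa)²`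
and `∫_{-a}^{a} t² dt = 2a³/3`): the small-offset size of the `sinh²` budget. [folklore] -/
theorem integral_sinh_mul_sq_le {η a : ℝ} (ha : 0 ≤ a) :
    ∫ t in (-a)..a, Real.sinh (η * t) ^ 2 ≤ 2 / 3 * η ^ 2 * a ^ 3 * Real.cosh (η * a) ^ 2 := by
  have hle : -a ≤ a := by linarith
  have hmono : ∫ t in (-a)..a, Real.sinh (η * t) ^ 2 ≤
      ∫ t in (-a)..a, η ^ 2 * Real.cosh (η * a) ^ 2 * t ^ 2 := by
    refine intervalIntegral.integral_mono_on hle ?_ ?_ fun t ht ↦ ?_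
    · apply Continuous.intervalIntegrable; fun_prop
    · apply Continuous.intervalIntegrable; fun_prop
    · have hta : |t| ≤ a := abs_le.2 ⟨ht.1, ht.2⟩
      calc Real.sinh (η * t) ^ 2 ≤ η ^ 2 * t ^ 2 * Real.cosh (η * a) ^ 2 := sinh_mul_sq_le hta
        _ = η ^ 2 * Real.cosh (η * a) ^ 2 * t ^ 2 := by ring
  rw [intervalIntegral.integral_const_mul, integral_pow] at hmono
  calc ∫ t in (-a)..a, Real.sinh (η * t) ^ 2
      ≤ η ^ 2 * Real.cosh (η * a) ^ 2 * ((a ^ (2 + 1) - (-a) ^ (2 + 1)) / (2 + 1)) := hmono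
    _ = 2 / 3 * η ^ 2 * a ^ 3 * Real.cosh (η * a) ^ 2 := by ring

/-- Closed form and small-offset bound combined: `sinh(ηa) cosh(ηa)/η − a ≤ (2/3) η² a³ cosh(ηa)²`
(`η ≠ 0`, `a ≥ 0`). [folklore] -/
theorem offsetBudget_le_small {η a : ℝ} (hη : η ≠ 0) (ha : 0 ≤ a) :
    Real.sinh (η * a) * Real.cosh (η * a) / η - a ≤ 2 / 3 * η ^ 2 * a ^ 3 * Real.cosh (η * a) ^ 2 := by
  rw [← integral_sinh_mul_sq hη a]
  exact integral_sinh_mul_sq_le ha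

/-- The budget is non-negative: `0 ≤ sinh(ηa) cosh(ηa)/η − a` (`η ≠ 0`, `a ≥ 0`). [folklore] -/
theorem offsetBudget_nonneg {η a : ℝ} (hη : η ≠ 0) (ha : 0 ≤ a) :
    0 ≤ Real.sinh (η * a) * Real.cosh (η * a) / η - a := by
  rw [← integral_sinh_mul_sq hη a]
  exact intervalIntegral.integral_nonneg (by linarith) fun t _ ↦ sq_nonneg _

/-! ## §3 The offset-blindness budget of one off-line zero -/

/-- Set integral over `Icc (-a) a` as an interval integral (Lebesgue measure has no atoms). [folklore] -/
theorem setIntegral_Icc_eq_intervalIntegral {a : ℝ} (ha : 0 ≤ a) (f : ℝ → ℝ) :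
    ∫ t in Icc (-a) a, f t = ∫ t in (-a)..a, f t := by
  rw [intervalIntegral.integral_of_le (by linarith), integral_Icc_eq_integral_Ioc]

/-- **Offset-blindness budget, abstract real form.**  For continuous real `u`, `w` with `|w| ≤ 1` and
`∫_{[-a,a]} u² = 1` (`a ≥ 0`, `η ≠ 0`):
`(∫_{[-a,a]} u(t) sinh(ηt) w(t) dt)² ≤ sinh(ηa) cosh(ηa)/η − a`
(Cauchy–Schwarz, `w² ≤ 1`, §2).  With `w = sin(γ·)` this is the even-sector defect of an off-line
quadruple at `1/2 ± η ± iγ`, with `w = cos(γ·)` the odd-sector one, with `w = 1` (odd `u`) the real pair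
`1/2 ± η` — uniformly in the height `γ`. [folklore] -/
theorem sq_setIntegral_mul_sinh_mul_le {a η : ℝ} (ha : 0 ≤ a) (hη : η ≠ 0) {u w : ℝ → ℝ}
    (hu : Continuous u) (hw : Continuous w) (hw1 : ∀ t, |w t| ≤ 1)
    (hnorm : ∫ t in Icc (-a) a, u t ^ 2 = 1) :
    (∫ t in Icc (-a) a, u t * (Real.sinh (η * t) * w t)) ^ 2 ≤
      Real.sinh (η * a) * Real.cosh (η * a) / η - a := by
  have hk_cont : Continuous fun t : ℝ ↦ Real.sinh (η * t) * w t := by fun_prop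
  have hCS := sq_integral_mul_le (μ := volume.restrict (Icc (-a) a))
    ((hu.pow 2).integrableOn_Icc (a := -a) (b := a))
    ((hk_cont.pow 2).integrableOn_Icc (a := -a) (b := a))
    ((hu.mul hk_cont).integrableOn_Icc (a := -a) (b := a))
  rw [hnorm, one_mul] at hCS
  refine hCS.trans ?_
  -- `∫_{[-a,a]} sinh² w² ≤ ∫_{[-a,a]} sinh² = closed form`
  have hmono : ∫ t in Icc (-a) a, (fun t : ℝ ↦ Real.sinh (η * t) * w t) t ^ 2 ≤
      ∫ t in Icc (-a) a, Real.sinh (η * t) ^ 2 := by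
    refine setIntegral_mono_on ((hk_cont.pow 2).integrableOn_Icc)
      ((by fun_prop : Continuous fun t : ℝ ↦ Real.sinh (η * t) ^ 2).integrableOn_Icc)
      measurableSet_Icc fun t _ ↦ ?_
    have hw2 : w t ^ 2 ≤ 1 := by
      have := hw1 t
      rw [← sq_abs]
      nlinarith [abs_nonneg (w t)]
    calc (Real.sinh (η * t) * w t) ^ 2 = Real.sinh (η * t) ^ 2 * w t ^ 2 := by ring
      _ ≤ Real.sinh (η * t) ^ 2 * 1 := mul_le_mul_of_nonneg_left hw2 (sq_nonneg _)
      _ = Real.sinh (η * t) ^ 2 := mul_one _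
  refine hmono.trans (le_of_eq ?_)
  rw [setIntegral_Icc_eq_intervalIntegral ha, integral_sinh_mul_sq hη]

/-- The same budget in its small-offset form `(2/3) η² a³ cosh(ηa)²`. [folklore] -/
theorem sq_setIntegral_mul_sinh_mul_le_small {a η : ℝ} (ha : 0 ≤ a) (hη : η ≠ 0) {u w : ℝ → ℝ}
    (hu : Continuous u) (hw : Continuous w) (hw1 : ∀ t, |w t| ≤ 1)
    (hnorm : ∫ t in Icc (-a) a, u t ^ 2 = 1) :
    (∫ t in Icc (-a) a, u t * (Real.sinh (η * t) * w t)) ^ 2 ≤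
      2 / 3 * η ^ 2 * a ^ 3 * Real.cosh (η * a) ^ 2 :=
  (sq_setIntegral_mul_sinh_mul_le ha hη hu hw hw1 hnorm).trans (offsetBudget_le_small hη ha)

/-- **Offset blindness of the Weil window form (imaginary part).**  For a REAL EVEN `L²`-normalised
Weil test `e` supported in `[-a, a]` (`a ≥ 0`) and ANY `ρ` with `Re ρ ≠ 1/2`, writing `η = Re ρ − 1/2`:
`(Im ê(ρ))² ≤ sinh(ηa) cosh(ηa)/η − a` — the tree's per-zero Cauchy–Schwarz threshold
(`neg_integral_sinh_sq_mul_sin_sq_le`) in closed form, uniform in `Im ρ`. [folklore] -/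
theorem im_weilMellin_sq_le_offsetBudget {a : ℝ} (ha : 0 ≤ a) {e : ℝ → ℂ} (he : IsWeilTest e)
    (hsupp : tsupport e ⊆ Icc (-a) a) (heven : ∀ t, e (-t) = e t) (hreal : ∀ t, (e t).im = 0)
    (hnorm : ∫ t, ‖e t‖ ^ 2 = (1 : ℝ)) {ρ : ℂ} (hρ : ρ.re ≠ 1 / 2) :
    (weilMellin e ρ).im ^ 2 ≤
      Real.sinh ((ρ.re - 1 / 2) * a) * Real.cosh ((ρ.re - 1 / 2) * a) / (ρ.re - 1 / 2) - a := by
  have hη : ρ.re - 1 / 2 ≠ 0 := sub_ne_zero.2 hρ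
  have hu_cont : Continuous fun t ↦ (e t).re := Complex.continuous_re.comp he.1.continuous
  -- `∫_{[-a,a]} (Re e)² = ∫ |e|² = 1`
  have hA : ∫ t in Icc (-a) a, (fun t ↦ (e t).re) t ^ 2 = 1 := by
    have h1 : (fun t ↦ (fun t ↦ (e t).re) t ^ 2) = fun t ↦ ‖e t‖ ^ 2 := by
      funext t
      rw [Complex.sq_norm, Complex.normSq_apply, hreal t]
      ring
    rw [h1, setIntegral_eq_integral_of_forall_compl_eq_zero, hnorm]
    intro t ht
    have h0 : e t = 0 := image_eq_zero_of_notMem_tsupport fun h ↦ ht (hsupp h)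
    simp [h0]
  rw [im_weilMellin_of_real_even he hsupp heven hreal ρ]
  exact sq_setIntegral_mul_sinh_mul_le ha hη hu_cont (by fun_prop) (fun t ↦ Real.abs_sin_le_one _) hA

/-- **Offset blindness, small-offset form**: `(Im ê(ρ))² ≤ (2/3) η² a³ cosh(ηa)²`. [folklore] -/
theorem im_weilMellin_sq_le_offsetBudget_small {a : ℝ} (ha : 0 ≤ a) {e : ℝ → ℂ} (he : IsWeilTest e)
    (hsupp : tsupport e ⊆ Icc (-a) a) (heven : ∀ t, e (-t) = e t) (hreal : ∀ t, (e t).im = 0)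
    (hnorm : ∫ t, ‖e t‖ ^ 2 = (1 : ℝ)) {ρ : ℂ} (hρ : ρ.re ≠ 1 / 2) :
    (weilMellin e ρ).im ^ 2 ≤
      2 / 3 * (ρ.re - 1 / 2) ^ 2 * a ^ 3 * Real.cosh ((ρ.re - 1 / 2) * a) ^ 2 :=
  (im_weilMellin_sq_le_offsetBudget ha he hsupp heven hreal hnorm hρ).trans
    (offsetBudget_le_small (sub_ne_zero.2 hρ) ha)

/-- **Offset blindness of the pair term.**  For a real even unit Weil test `e` supported in `[-a, a]`
and any `ρ` off the line: `Re (ê(ρ)²) ≥ −(2/3) η² a³ cosh(ηa)²`, `η = Re ρ − 1/2`; i.e. an off-line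
quadruple `{1/2 ± η ± iγ}` (zero-side weight `4 Re ê²` on even tests) lowers the depth-`a` window form on
`e` by at most `(8/3) η² a³ cosh(ηa)²`, whatever `γ`. [folklore] -/
theorem re_weilMellin_sq_ge_neg_offsetBudget {a : ℝ} (ha : 0 ≤ a) {e : ℝ → ℂ} (he : IsWeilTest e)
    (hsupp : tsupport e ⊆ Icc (-a) a) (heven : ∀ t, e (-t) = e t) (hreal : ∀ t, (e t).im = 0)
    (hnorm : ∫ t, ‖e t‖ ^ 2 = (1 : ℝ)) {ρ : ℂ} (hρ : ρ.re ≠ 1 / 2) :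
    -(2 / 3 * (ρ.re - 1 / 2) ^ 2 * a ^ 3 * Real.cosh ((ρ.re - 1 / 2) * a) ^ 2) ≤
      ((weilMellin e ρ) ^ 2).re := by
  have hre : ((weilMellin e ρ) ^ 2).re = (weilMellin e ρ).re ^ 2 - (weilMellin e ρ).im ^ 2 := by
    rw [sq, Complex.mul_re]
    ring
  rw [hre]
  nlinarith [im_weilMellin_sq_le_offsetBudget_small ha he hsupp heven hreal hnorm hρ,
    sq_nonneg (weilMellin e ρ).re]

end Summit.RiemannHypothesis.RiemannHypothesis.Theorems.PfPersistence

end
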